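import Summits.QuantumFields.BalabanUV.T4Continuum.Support.NE3FrameFreeDecompositionPrep
import Mathlib.Analysis.InnerProductSpace.PiL2
import HarnessLib

/-!
# NE3HilbertSchmidtTorus (T⁴ programme, node NE3, row K1-inst of the owner's ruling ρ-g22-2, file 2∕4) — THE REAL HILBERT–SCHMIDT
# INNER-PRODUCT SPACE OF 𝔤𝔩(n)-VALUED TORUS SECTIONS AND 1-FORMS, AND THE COVARIANT DERIVATIVE `D_W = gaugeDir W` AS AN `ℝ`-LINEAR MAP

NE3 (node U1b) formalisation swarm `b2b-balaban-t4-ne3-formalise-*`, leaf seat `b2b-balaban-t4-ne3-formalise-leaf-02` (gen 6), row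
**K1-inst** of the owner's ruling ρ-g22-2 («package `D_W` on periodic 𝔤-valued sections as a `LinearMap` between `PiLp` spaces», owner journal
l.17786 ∕ l.18064; design `HOME/t4/b2b-balaban-t4-ne3-p1/g22/D-ne3p1-g22-1.md` steps S1∕S2; my INTENT ∕ CLAIM `HOME/CLAIMS.log` l.18383).
THE ROW'S FILES: (1∕4) `NE3SpectralCutSymmetry` (abstract supplement to the owner's kit `NE3SpectralCut` p227224 ∕ `NE3SpectralCutGram` p227494),
(2∕4) `NE3HilbertSchmidtTorus` (the real Hilbert–Schmidt `PiLp` packaging and `DW W P`), (3∕4) `NE3CovariantAdjointTorus` (`D_W† = covDiv W`,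
the anti-involution `X ↦ −Xᴴ`, the torus Hodge split), (4∕4) `NE3SpectralCutTorus` (S2 and S1 in lattice currency + the S1∘S2 package).
THIS FILE supplies the concrete spaces and the concrete `D` for the kit's Gram operator `D† ∘ D`:
§1 the type synonym **`HSMat n`** of `Matrix n n ℂ` carrying the `InnerProductSpace ℝ` structure OF THE TREE'S REAL HILBERT–SCHMIDT FORM
   `NE3CovariantCalculus.hsR` (`⟪X, Y⟫ = hsR X Y = Re tr(XᴴY)∕n`, `‖X‖² = nhsNormSq X`; built with `InnerProductSpace.Core` on the synonym — the tree's
   `Matrix n n ℂ` keeps its (scoped) L²-operator norm, there is no instance clash: compare leaf-02-g5's remark in `NE3CornerGaugeSpace` and leaf-01-g5's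
   `PiLp` packaging of inner-product-space values in `NE3TorusProjection`); identities `toHS`∕`ofHS`;
§2 torus sections `Sec d n P = PiLp 2 (fun _ : (Fin d → Fin P) ↦ HSMat n)` and torus 1-forms `Form d n P = PiLp 2 (fun _ : (Fin d → Fin P) × Fin d ↦ HSMat n)`
   with the dictionary periodic lattice field ↔ torus datum (`extS`∕`resS`∕`extF`∕`resF` over row NE3-R2's `AveragingDeficitTorusChart.redN`∕`boxVec`):
   inner products and norms ARE the `periodBox P` sums of `hsR`∕`nhsNormSq` (`inner_resS`, `inner_resF`, `norm_sq_resS`, `norm_sq_resF`, `…_eq_sum_ext…`);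
§3 **`DW W P : Sec d n P →ₗ[ℝ] Form d n P`**, `DW W P a = resF P (gaugeDir W (extS P a))` (the tree's `BlockAveragePushDirGauge.gaugeDir`), `DW_resS`
   (on a `P`-periodic `ζ` it is `gaugeDir W ζ` restricted), `extF_DW`, **`norm_sq_DW`** (`‖D_W a‖² = Σ_{periodBox} Σ_κ nhsNormSq (gaugeDir W (extS a) x κ)`),
   `inner_DW_right`.  The adjoint `D_W† = covDiv W` is file 3.
All [folklore]; 0 sorry; DATA defs `HSMat`, `HSMat.toHS`, `HSMat.ofHS`, `HSMat.core` (+ instances), `Sec`, `Form`, `extS`, `resS`, `extF`, `resF`, `DW`;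
no `def … : Prop`.  Imports leaf-02-g5's `NE3FrameFreeDecompositionPrep` (for `hsR_smul_left`; it carries leaf-04's `NE3LandauOrbit` and
leaf-03's `NE3CovariantCalculus`∕`NE3CovariantWeitzenbock`) + Mathlib `InnerProductSpace.PiL2`.
HONEST FRAMING.  Finite-dimensional linear algebra on OUR lattice objects at ONE unitary background; nothing about Bałaban's minimisers;
(P♮)_W, (ML_w) at `W ≠ 1`, T-E_w and NE3 are NOT proved; spine PROVED 0∕9; finite T⁴ rung (B)+1 — NOT infinite volume, NOT mass gap, NOT
BetaPertH, NOT Clay.  ABSOLUTE RULE kept: no printed sentence is a hypothesis (context only: [Balaban1985Averaging] (17)–(19) pp. 20–21, the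
normalised Hilbert–Schmidt scalar product; [Balaban1985Variational] (83) p. 290, the Landau-gauge restriction).  PLACEMENT:
`Summits/QuantumFields/BalabanUV/` (our frame); moves nothing.  HONEST DEPENDENCY: continuum YM on T⁴ ⇐ BetaPertH ∧ nine spine estimates
(0/9 proved); BetaPertH ⇐ (D1) ∧ (D4) ∧ CAP+tail; G-an2-4 gates asym, D1 and NE2/3/4.
-/

set_option autoImplicit false

open scoped BigOperators InnerProductSpace
open Finset

namespace Summit.QuantumFields.BalabanUV.T4Continuum.NE3HilbertSchmidtTorus

open Literature.MathematicalPhysics.QuantumFieldTheory.Balaban1983to89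
open B7Prop1Explicit MatrixNorms
open T4AveragingDeficitWall (IsUnitaryCfg Ad)
open T4AveragingDeficitWallBoundary (IsPeriodicCfg periodBox)
open AveragingDeficitPeriodicCounting (IsPeriodicDir)
open AveragingDeficitNearIdentity (Ad_add Ad_real_smul)
open AveragingDeficitTorusChart (redN redN_boxVec redN_add_smul eq_wrap_add periodic_smul_vec)
open NE3BlockLineAverage (sum_univ_boxVec)
open BlockAveragePushDirGauge (gaugeDir isPeriodicDir_gaugeDir)
open NE3CovariantCalculus (hsR hsR_add_left hsR_self hsR_comm)
open NE3CovariantWeitzenbock (covDiv)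
open NE3LandauOrbit (eq_zero_of_nhsNormSq_eq_zero)
open NE3FrameFreeDecompositionPrep (hsR_smul_left)

noncomputable section

/-! ## §1 The real Hilbert–Schmidt inner-product space `HSMat n` -/

/-- **`HSMat n`**: the type synonym of `Matrix n n ℂ` that carries the REAL HILBERT–SCHMIDT inner product `hsR` (and the norm
`‖X‖² = nhsNormSq X`) as instances. [folklore] -/
def HSMat (n : Type*) : Type _ := Matrix n n ℂ

namespace HSMat

variable {n : Type*}

/-- The additive group structure of `Matrix n n ℂ`, transported verbatim. [folklore] -/
instance instAddCommGroup : AddCommGroup (HSMat n) := inferInstanceAs (AddCommGroup (Matrix n n ℂ))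

/-- The real module structure of `Matrix n n ℂ`, transported verbatim. [folklore] -/
instance instModule : Module ℝ (HSMat n) := inferInstanceAs (Module ℝ (Matrix n n ℂ))

/-- The identity `Matrix n n ℂ → HSMat n`. [folklore] -/
def toHS (X : Matrix n n ℂ) : HSMat n := X

/-- The identity `HSMat n → Matrix n n ℂ`. [folklore] -/
def ofHS (A : HSMat n) : Matrix n n ℂ := A

/-- `ofHS (toHS X) = X`. [folklore] -/
@[simp] theorem ofHS_toHS (X : Matrix n n ℂ) : ofHS (toHS X) = X := rfl

/-- `toHS (ofHS A) = A`. [folklore] -/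
@[simp] theorem toHS_ofHS (A : HSMat n) : toHS (ofHS A) = A := rfl

/-- `ofHS` is additive. [folklore] -/
@[simp] theorem ofHS_add (A B : HSMat n) : ofHS (A + B) = ofHS A + ofHS B := rfl

/-- `ofHS` is subtractive. [folklore] -/
@[simp] theorem ofHS_sub (A B : HSMat n) : ofHS (A - B) = ofHS A - ofHS B := rfl

/-- `ofHS 0 = 0`. [folklore] -/
@[simp] theorem ofHS_zero : ofHS (0 : HSMat n) = 0 := rfl

/-- `ofHS` commutes with real scalars. [folklore] -/
@[simp] theorem ofHS_smul (t : ℝ) (A : HSMat n) : ofHS (t • A) = t • ofHS A := rfl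

/-- `toHS` is additive. [folklore] -/
@[simp] theorem toHS_add (X Y : Matrix n n ℂ) : toHS (X + Y) = toHS X + toHS Y := rfl

/-- `toHS` is subtractive. [folklore] -/
@[simp] theorem toHS_sub (X Y : Matrix n n ℂ) : toHS (X - Y) = toHS X - toHS Y := rfl

/-- `toHS 0 = 0`. [folklore] -/
@[simp] theorem toHS_zero : toHS (0 : Matrix n n ℂ) = (0 : HSMat n) := rfl

/-- `toHS` commutes with real scalars. [folklore] -/
@[simp] theorem toHS_smul (t : ℝ) (X : Matrix n n ℂ) : toHS (t • X) = t • toHS X := rfl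

variable [Fintype n] [DecidableEq n]

/-- `HSMat n` is finite-dimensional over `ℝ` (as `Matrix n n ℂ` is). [folklore] -/
instance instFiniteDimensional : FiniteDimensional ℝ (HSMat n) := inferInstanceAs (FiniteDimensional ℝ (Matrix n n ℂ))

/-- THE CORE: the inner product `⟪A, B⟫ := hsR (ofHS A) (ofHS B)` is symmetric, additive, `ℝ`-homogeneous, non-negative and
DEFINITE on `Matrix n n ℂ` (the only `Inner` instance of `HSMat n` is the one this core induces). [folklore] -/
@[reducible] def core : InnerProductSpace.Core ℝ (HSMat n) where
  inner A B := hsR (ofHS A) (ofHS B)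
  conj_inner_symm A B := by
    show (starRingEnd ℝ) (hsR (ofHS B) (ofHS A)) = hsR (ofHS A) (ofHS B)
    rw [starRingEnd_apply, star_trivial, hsR_comm]
  re_inner_nonneg A := by
    show 0 ≤ RCLike.re (hsR (ofHS A) (ofHS A))
    rw [RCLike.re_to_real, hsR_self]
    exact nhsNormSq_nonneg _
  add_left A B C := by
    show hsR (ofHS (A + B)) (ofHS C) = hsR (ofHS A) (ofHS C) + hsR (ofHS B) (ofHS C)
    rw [ofHS_add, hsR_add_left]
  smul_left A B t := by
    show hsR (ofHS (t • A)) (ofHS B) = (starRingEnd ℝ) t * hsR (ofHS A) (ofHS B)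
    rw [starRingEnd_apply, star_trivial, ofHS_smul, hsR_smul_left]
  definite A hA := by
    have h : hsR (ofHS A) (ofHS A) = 0 := hA
    rw [hsR_self] at h
    exact eq_zero_of_nhsNormSq_eq_zero h

/-- THE HILBERT–SCHMIDT NORM `‖X‖ = (nhsNormSq X)^{1∕2}` as the norm of `HSMat n` (from the core). [folklore] -/
instance instNormedAddCommGroup : NormedAddCommGroup (HSMat n) :=
  @InnerProductSpace.Core.toNormedAddCommGroup ℝ (HSMat n) _ _ _ core

/-- THE REAL HILBERT–SCHMIDT INNER-PRODUCT SPACE structure of `HSMat n` (from the core). [folklore] -/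
instance instInnerProductSpace : InnerProductSpace ℝ (HSMat n) := InnerProductSpace.ofCore _

/-- The inner product of `HSMat n` is the tree's `hsR`. [folklore] -/
theorem inner_def (A B : HSMat n) : ⟪A, B⟫_ℝ = hsR (ofHS A) (ofHS B) := rfl

/-- `⟪toHS X, toHS Y⟫ = hsR X Y`. [folklore] -/
@[simp] theorem inner_toHS (X Y : Matrix n n ℂ) : ⟪toHS X, toHS Y⟫_ℝ = hsR X Y := rfl

/-- `‖A‖² = nhsNormSq (ofHS A)`. [folklore] -/
theorem norm_sq_eq (A : HSMat n) : ‖A‖ ^ 2 = nhsNormSq (ofHS A) := by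
  rw [← real_inner_self_eq_norm_sq, inner_def, hsR_self]

/-- `‖toHS X‖² = nhsNormSq X`. [folklore] -/
@[simp] theorem norm_toHS_sq (X : Matrix n n ℂ) : ‖toHS X‖ ^ 2 = nhsNormSq X := norm_sq_eq _

end HSMat

open HSMat

/-! ## §2 Torus sections and torus 1-forms; the dictionary with periodic lattice fields -/

variable {d : ℕ} {n : Type*}

variable (d n) in
/-- Torus SECTIONS (𝔤𝔩(n)-valued site fields on `(ℤ∕P)^d`) as a real finite-dimensional Hilbert space. [folklore] -/
abbrev Sec (P : ℕ) : Type _ := PiLp 2 (fun _ : (Fin d → Fin P) => HSMat n)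

variable (d n) in
/-- Torus 1-FORMS (𝔤𝔩(n)-valued bond fields on `(ℤ∕P)^d`) as a real finite-dimensional Hilbert space. [folklore] -/
abbrev Form (P : ℕ) : Type _ := PiLp 2 (fun _ : (Fin d → Fin P) × Fin d => HSMat n)

/-- Periodic extension of a torus section to a lattice site field. [folklore] -/
def extS (P : ℕ) [NeZero P] (a : Sec d n P) : Site d → Matrix n n ℂ := fun x => ofHS (a (redN P x))

/-- Restriction of a lattice site field to the torus representatives. [folklore] -/
def resS (P : ℕ) (f : Site d → Matrix n n ℂ) : Sec d n P := WithLp.toLp 2 fun s => toHS (f (boxVec P s))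

/-- Periodic extension of a torus 1-form to a lattice direction field. [folklore] -/
def extF (P : ℕ) [NeZero P] (b : Form d n P) : Site d → Fin d → Matrix n n ℂ := fun x κ => ofHS (b (redN P x, κ))

/-- Restriction of a lattice direction field to the torus bonds. [folklore] -/
def resF (P : ℕ) (Y : Site d → Fin d → Matrix n n ℂ) : Form d n P := WithLp.toLp 2 fun p => toHS (Y (boxVec P p.1) p.2)

/-- `resS f` evaluated. [folklore] -/
@[simp] theorem resS_apply (P : ℕ) (f : Site d → Matrix n n ℂ) (s : Fin d → Fin P) : resS P f s = toHS (f (boxVec P s)) := rfl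

/-- `resF Y` evaluated. [folklore] -/
@[simp] theorem resF_apply (P : ℕ) (Y : Site d → Fin d → Matrix n n ℂ) (p : (Fin d → Fin P) × Fin d) :
    resF P Y p = toHS (Y (boxVec P p.1) p.2) := rfl

/-- `extS a` is `P`-periodic. [folklore] -/
theorem extS_add_period (P : ℕ) [NeZero P] (a : Sec d n P) (x : Site d) (τ : Fin d) :
    extS P a (x + (P : ℤ) • e τ) = extS P a x := by
  simp only [extS, redN_add_smul]

/-- `extF b` is `P`-periodic. [folklore] -/
theorem isPeriodicDir_extF (P : ℕ) [NeZero P] (b : Form d n P) : IsPeriodicDir (extF P b) (P : ℤ) := by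
  intro x τ μ
  simp only [extF, redN_add_smul]

/-- `extS a` on the representatives. [folklore] -/
@[simp] theorem extS_boxVec (P : ℕ) [NeZero P] (a : Sec d n P) (s : Fin d → Fin P) : extS P a (boxVec P s) = ofHS (a s) := by
  simp only [extS, redN_boxVec]

/-- `extF b` on the representatives. [folklore] -/
@[simp] theorem extF_boxVec (P : ℕ) [NeZero P] (b : Form d n P) (s : Fin d → Fin P) (κ : Fin d) :
    extF P b (boxVec P s) κ = ofHS (b (s, κ)) := by
  simp only [extF, redN_boxVec]

/-- `resS ∘ extS = id`. [folklore] -/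
@[simp] theorem resS_extS (P : ℕ) [NeZero P] (a : Sec d n P) : resS P (extS P a) = a := by
  ext s : 1
  rw [resS_apply, extS_boxVec, toHS_ofHS]

/-- `resF ∘ extF = id`. [folklore] -/
@[simp] theorem resF_extF (P : ℕ) [NeZero P] (b : Form d n P) : resF P (extF P b) = b := by
  ext p : 1
  rw [resF_apply, extF_boxVec, toHS_ofHS]

/-- `extS ∘ resS = id` on `P`-periodic site fields. [folklore] -/
theorem extS_resS (P : ℕ) [NeZero P] {f : Site d → Matrix n n ℂ} (hf : ∀ (x : Site d) (τ : Fin d), f (x + (P : ℤ) • e τ) = f x) :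
    extS P (resS P f) = f := by
  funext x
  simp only [extS, resS_apply, ofHS_toHS]
  conv_rhs => rw [eq_wrap_add P x]
  exact (periodic_smul_vec hf _ _).symm

/-- `extF ∘ resF = id` on `P`-periodic direction fields. [folklore] -/
theorem extF_resF (P : ℕ) [NeZero P] {Y : Site d → Fin d → Matrix n n ℂ} (hY : IsPeriodicDir Y (P : ℤ)) :
    extF P (resF P Y) = Y := by
  funext x κ
  simp only [extF, resF_apply, ofHS_toHS]
  conv_rhs => rw [eq_wrap_add P x]
  exact (periodic_smul_vec (f := fun y => Y y κ) (fun y i => hY y i κ) _ _).symm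

/-- `extS` is additive. [folklore] -/
theorem extS_add (P : ℕ) [NeZero P] (a b : Sec d n P) (x : Site d) : extS P (a + b) x = extS P a x + extS P b x := rfl

/-- `extS` commutes with real scalars. [folklore] -/
theorem extS_smul (P : ℕ) [NeZero P] (t : ℝ) (a : Sec d n P) (x : Site d) : extS P (t • a) x = t • extS P a x := rfl

/-- `extS` is subtractive. [folklore] -/
theorem extS_sub (P : ℕ) [NeZero P] (a b : Sec d n P) (x : Site d) : extS P (a - b) x = extS P a x - extS P b x := rfl

/-- `extF` is additive. [folklore] -/
theorem extF_add (P : ℕ) [NeZero P] (a b : Form d n P) (x : Site d) (κ : Fin d) :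
    extF P (a + b) x κ = extF P a x κ + extF P b x κ := rfl

/-- `extF` is subtractive. [folklore] -/
theorem extF_sub (P : ℕ) [NeZero P] (a b : Form d n P) (x : Site d) (κ : Fin d) :
    extF P (a - b) x κ = extF P a x κ - extF P b x κ := rfl

/-- `resS` is additive. [folklore] -/
theorem resS_add (P : ℕ) (f g : Site d → Matrix n n ℂ) : resS P (fun x => f x + g x) = resS (d := d) P f + resS P g := by
  ext s : 1; rfl

/-- `resS` is subtractive. [folklore] -/
theorem resS_sub (P : ℕ) (f g : Site d → Matrix n n ℂ) : resS P (fun x => f x - g x) = resS (d := d) P f - resS P g := by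
  ext s : 1; rfl

/-- `resF` is additive. [folklore] -/
theorem resF_add (P : ℕ) (Y Z : Site d → Fin d → Matrix n n ℂ) :
    resF P (fun x κ => Y x κ + Z x κ) = resF (d := d) P Y + resF P Z := by
  ext p : 1; rfl

/-- `resF` is subtractive. [folklore] -/
theorem resF_sub (P : ℕ) (Y Z : Site d → Fin d → Matrix n n ℂ) :
    resF P (fun x κ => Y x κ - Z x κ) = resF (d := d) P Y - resF P Z := by
  ext p : 1; rfl

variable [Fintype n] [DecidableEq n]

/-- **`⟪resS f, resS g⟫ = Σ_{x∈periodBox P} hsR (f x) (g x)`**. [folklore] -/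
theorem inner_resS (P : ℕ) (f g : Site d → Matrix n n ℂ) :
    ⟪resS (d := d) P f, resS P g⟫_ℝ = ∑ x ∈ periodBox (d := d) P, hsR (f x) (g x) := by
  rw [PiLp.inner_apply, ← sum_univ_boxVec P (fun x => hsR (f x) (g x))]
  rfl

/-- **`⟪resF Y, resF Z⟫ = Σ_{x∈periodBox P} Σ_κ hsR (Y x κ) (Z x κ)`**. [folklore] -/
theorem inner_resF (P : ℕ) (Y Z : Site d → Fin d → Matrix n n ℂ) :
    ⟪resF (d := d) P Y, resF P Z⟫_ℝ = ∑ x ∈ periodBox (d := d) P, ∑ κ : Fin d, hsR (Y x κ) (Z x κ) := by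
  rw [PiLp.inner_apply, Fintype.sum_prod_type, ← sum_univ_boxVec P (fun x => ∑ κ : Fin d, hsR (Y x κ) (Z x κ))]
  rfl

/-- `‖resS f‖² = Σ_{x∈periodBox P} nhsNormSq (f x)`. [folklore] -/
theorem norm_sq_resS (P : ℕ) (f : Site d → Matrix n n ℂ) :
    ‖resS (d := d) P f‖ ^ 2 = ∑ x ∈ periodBox (d := d) P, nhsNormSq (f x) := by
  rw [← real_inner_self_eq_norm_sq, inner_resS]
  exact Finset.sum_congr rfl fun x _ => hsR_self _

/-- `‖resF Y‖² = Σ_{x∈periodBox P} Σ_κ nhsNormSq (Y x κ)`. [folklore] -/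
theorem norm_sq_resF (P : ℕ) (Y : Site d → Fin d → Matrix n n ℂ) :
    ‖resF (d := d) P Y‖ ^ 2 = ∑ x ∈ periodBox (d := d) P, ∑ κ : Fin d, nhsNormSq (Y x κ) := by
  rw [← real_inner_self_eq_norm_sq, inner_resF]
  exact Finset.sum_congr rfl fun x _ => Finset.sum_congr rfl fun κ _ => hsR_self _

/-- The inner product of two torus sections is the `periodBox` pairing of their extensions. [folklore] -/
theorem inner_eq_sum_extS (P : ℕ) [NeZero P] (a b : Sec d n P) :
    ⟪a, b⟫_ℝ = ∑ x ∈ periodBox (d := d) P, hsR (extS P a x) (extS P b x) := by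
  rw [← inner_resS, resS_extS, resS_extS]

/-- The norm of a torus section is the `periodBox` sum of `nhsNormSq` of its extension. [folklore] -/
theorem norm_sq_eq_sum_extS (P : ℕ) [NeZero P] (a : Sec d n P) :
    ‖a‖ ^ 2 = ∑ x ∈ periodBox (d := d) P, nhsNormSq (extS P a x) := by
  rw [← norm_sq_resS, resS_extS]

/-- The inner product of two torus 1-forms is the `periodBox` pairing of their extensions. [folklore] -/
theorem inner_eq_sum_extF (P : ℕ) [NeZero P] (a b : Form d n P) :
    ⟪a, b⟫_ℝ = ∑ x ∈ periodBox (d := d) P, ∑ κ : Fin d, hsR (extF P a x κ) (extF P b x κ) := by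
  rw [← inner_resF, resF_extF, resF_extF]

/-- The norm of a torus 1-form is the `periodBox` sum of `nhsNormSq` of its extension. [folklore] -/
theorem norm_sq_eq_sum_extF (P : ℕ) [NeZero P] (b : Form d n P) :
    ‖b‖ ^ 2 = ∑ x ∈ periodBox (d := d) P, ∑ κ : Fin d, nhsNormSq (extF P b x κ) := by
  rw [← norm_sq_resF, resF_extF]

/-! ## §3 The covariant derivative `D_W` as an `ℝ`-linear map -/

/-- `gaugeDir` is additive in the generator (function form). [folklore] -/
theorem gaugeDir_add_fun (W : Site d → Fin d → (Matrix n n ℂ)ˣ) (f g : Site d → Matrix n n ℂ) (x : Site d) (μ : Fin d) :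
    gaugeDir W (fun y => f y + g y) x μ = gaugeDir W f x μ + gaugeDir W g x μ := by
  simp only [gaugeDir, Ad_add]
  abel

/-- `gaugeDir` commutes with real scalars (function form). [folklore] -/
theorem gaugeDir_smul_fun (W : Site d → Fin d → (Matrix n n ℂ)ˣ) (t : ℝ) (f : Site d → Matrix n n ℂ) (x : Site d) (μ : Fin d) :
    gaugeDir W (fun y => t • f y) x μ = t • gaugeDir W f x μ := by
  simp only [gaugeDir, Ad_real_smul, smul_sub]

/-- `covDiv` is additive in the direction field (function form). [folklore] -/
theorem covDiv_add_fun (W : Site d → Fin d → (Matrix n n ℂ)ˣ) (Y Z : Site d → Fin d → Matrix n n ℂ) (x : Site d) :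
    covDiv W (fun y κ => Y y κ + Z y κ) x = covDiv W Y x + covDiv W Z x := by
  simp only [covDiv, Ad_add, ← Finset.sum_add_distrib]
  exact Finset.sum_congr rfl fun μ _ => by abel

/-- `covDiv` commutes with real scalars (function form). [folklore] -/
theorem covDiv_smul_fun (W : Site d → Fin d → (Matrix n n ℂ)ˣ) (t : ℝ) (Y : Site d → Fin d → Matrix n n ℂ) (x : Site d) :
    covDiv W (fun y κ => t • Y y κ) x = t • covDiv W Y x := by
  simp only [covDiv, Ad_real_smul, ← smul_sub, ← Finset.smul_sum]

/-- **`D_W` AS AN `ℝ`-LINEAR MAP** from torus sections to torus 1-forms: extend periodically, apply the tree's `gaugeDir W`,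
restrict to the torus bonds. [folklore] -/
def DW (W : Site d → Fin d → (Matrix n n ℂ)ˣ) (P : ℕ) [NeZero P] : Sec d n P →ₗ[ℝ] Form d n P where
  toFun a := resF P (gaugeDir W (extS P a))
  map_add' a b := by
    ext p : 1
    simp only [resF_apply, PiLp.add_apply]
    rw [← toHS_add, ← gaugeDir_add_fun]
    rfl
  map_smul' t a := by
    ext p : 1
    simp only [resF_apply, PiLp.smul_apply, RingHom.id_apply]
    rw [← toHS_smul, ← gaugeDir_smul_fun]
    rfl

/-- `DW W P a = resF P (gaugeDir W (extS P a))`. [folklore] -/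
theorem DW_apply (W : Site d → Fin d → (Matrix n n ℂ)ˣ) (P : ℕ) [NeZero P] (a : Sec d n P) :
    DW W P a = resF P (gaugeDir W (extS P a)) := rfl

/-- On a `P`-periodic section, `DW` is `gaugeDir W` restricted to the torus. [folklore] -/
theorem DW_resS (W : Site d → Fin d → (Matrix n n ℂ)ˣ) (P : ℕ) [NeZero P] {ζ : Site d → Matrix n n ℂ}
    (hζ : ∀ (x : Site d) (τ : Fin d), ζ (x + (P : ℤ) • e τ) = ζ x) : DW W P (resS P ζ) = resF P (gaugeDir W ζ) := by
  rw [DW_apply, extS_resS P hζ]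

/-- The extension of `DW a` is `gaugeDir W (extS a)` for a `P`-periodic background. [folklore] -/
theorem extF_DW {W : Site d → Fin d → (Matrix n n ℂ)ˣ} {P : ℕ} [NeZero P] (hWP : IsPeriodicCfg W (P : ℤ)) (a : Sec d n P) :
    extF P (DW W P a) = gaugeDir W (extS P a) := by
  rw [DW_apply, extF_resF P (isPeriodicDir_gaugeDir hWP (extS_add_period P a))]

/-- **`‖D_W a‖² = Σ_{x∈periodBox P} Σ_κ nhsNormSq (gaugeDir W (extS a) x κ)`**. [folklore] -/
theorem norm_sq_DW (W : Site d → Fin d → (Matrix n n ℂ)ˣ) (P : ℕ) [NeZero P] (a : Sec d n P) :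
    ‖DW W P a‖ ^ 2 = ∑ x ∈ periodBox (d := d) P, ∑ κ : Fin d, nhsNormSq (gaugeDir W (extS P a) x κ) := by
  rw [DW_apply, norm_sq_resF]

/-- `‖D_W (resS ζ)‖² = Σ Σ_κ nhsNormSq (gaugeDir W ζ x κ)` for a `P`-periodic `ζ`. [folklore] -/
theorem norm_sq_DW_resS (W : Site d → Fin d → (Matrix n n ℂ)ˣ) (P : ℕ) [NeZero P] {ζ : Site d → Matrix n n ℂ}
    (hζ : ∀ (x : Site d) (τ : Fin d), ζ (x + (P : ℤ) • e τ) = ζ x) :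
    ‖DW W P (resS P ζ)‖ ^ 2 = ∑ x ∈ periodBox (d := d) P, ∑ κ : Fin d, nhsNormSq (gaugeDir W ζ x κ) := by
  rw [DW_resS W P hζ, norm_sq_resF]

/-- `⟪b, D_W a⟫ = Σ_{x∈periodBox P} Σ_κ hsR (extF b x κ) (gaugeDir W (extS a) x κ)`. [folklore] -/
theorem inner_DW_right (W : Site d → Fin d → (Matrix n n ℂ)ˣ) (P : ℕ) [NeZero P] (b : Form d n P) (a : Sec d n P) :
    ⟪b, DW W P a⟫_ℝ = ∑ x ∈ periodBox (d := d) P, ∑ κ : Fin d, hsR (extF P b x κ) (gaugeDir W (extS P a) x κ) := by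
  conv_lhs => rw [← resF_extF P b]
  rw [DW_apply, inner_resF]


end

end Summit.QuantumFields.BalabanUV.T4Continuum.NE3HilbertSchmidtTorus
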